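import Literature.Probability.Percolation.QuadCrossingDualityConverse
import Literature.Probability.Percolation.QuadDualExploration
import Literature.Probability.Percolation.OpenPathAnnulusCrossing
import HarnessLib

/-!
# The bottom open cluster of a quad and the infimal landing height of dual crossings

Topic `Probability/Percolation`; proofs file towards the named fact `SchrammSmirnov2011_lemma_6_1`
(`QuadCrossingContinuity.lean`; O. Schramm, S. Smirnov, *On the scaling limits of planar
percolation*, Ann. Probab. 39 (2011), arXiv:1101.5820, proof of Lemma 6.1, p. 23: "the proof in
case (3) is symmetric to that of case (2)").

After the relabelling `Quad.rot` (`QuadCrossingRot.lean`), case (3) of Lemma 6.1 is case (2) with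
open crossings replaced by DUAL crossings: paths in `[Q]` from `∂₀Q` to `∂₂Q` avoiding the drawn
open edges `O`.  The "lowest crossing" of the printed proof then becomes the lowest dual crossing,
which is not attained (the free space is open); what IS a lattice object is the **bottom open
cluster** `C_b(ω)`: the union of the open edge pieces of `[Q]` chained to `∂₁Q` through
intersecting open pieces (`Quad.bottomCluster`; the pieces `segment ∩ [Q]` are connected for
lattice-tame quads).  This file proves that its top contact with the free side,
`θ_C = Quad.topContact` (the largest parameter `θ` with `Q(1, θ) ∈ C_b`, or `0`), is exactly the
infimal landing height of dual crossings:

* `Quad.topContact_le_of_dualPath` — every dual crossing from `∂₀Q` landing on `∂₂Q` at its first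
  visit lands at a parameter `≥ θ_C` (the chain of open pieces from `∂₁Q` to the contact, continued
  by the arc of `∂₂Q` above the landing point, would be a connected set joining `∂₁Q` to `∂₃Q` off
  the dual path);
* `Quad.exists_dualPath_landing_lt` — if some dual crossing exists, then for every `η > 0` there is
  a dual crossing of `[Q]` from `∂₀Q` to `∂₂Q` avoiding `O` all of whose points on `∂₂Q` have
  parameter `< θ_C + η` (the dual-path lemma `Quad.exists_path_avoiding_of_not_crossed'` with the
  arc `{θ ≥ θ_C + η}` of `∂₂Q` added to the obstacle: a connected piece of obstacle joining `∂₁Q` to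
  `∂₃Q` would chain open pieces from `∂₁Q` either to `∂₃Q` — excluded by the given dual crossing —
  or to the added arc — excluded by the definition of `θ_C`; the chain is extracted by
  `exists_reflTransGen_of_isPreconnected`, a finite-cover connectivity lemma).

This is the "wall point" of the dual exploration for case (3).  Everything is proved; no named
fact is introduced.

## References

* O. Schramm, S. Smirnov, Ann. Probab. 39 (2011) 1768–1814, arXiv:1101.5820, proof of Lemma 6.1.
  [SchrammSmirnov2011]
* G. Grimmett, *Percolation*, 2nd ed. (1999), §11.2 (lowest crossings, duality). [GrimmettPercolation1999]
-/

noncomputable section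

open scoped unitInterval
open Set Filter Metric Function Relation
open _root_.Topology
open Literature.Probability.LatticeModels

namespace Literature.Probability.Percolation

namespace QuadCrossing

variable {D : Set ℂ}

/-! ### A finite-cover connectivity lemma -/

/-- **Chains in a finite closed cover of a connected set.**  Let `P i` (`i : ι`) be closed sets,
only finitely many of them nonempty, covering a preconnected set `C`.  If `C` meets `P i₁` and
`P i₂`, then `i₁` and `i₂` are joined by a chain of indices whose consecutive sets intersect and
all meet `C`. [folklore] -/
theorem exists_reflTransGen_of_isPreconnected {ι : Type*} (P : ι → Set ℂ)
    (hclosed : ∀ i, IsClosed (P i)) (hfin : {i | (P i).Nonempty}.Finite) {C : Set ℂ}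
    (hC : IsPreconnected C) (hCsub : C ⊆ ⋃ i, P i) {i₁ i₂ : ι} (h₁ : (C ∩ P i₁).Nonempty)
    (h₂ : (C ∩ P i₂).Nonempty) :
    ReflTransGen (fun i j => (C ∩ P j).Nonempty ∧ (P i ∩ P j).Nonempty) i₁ i₂ := by
  set r : ι → ι → Prop := fun i j => (C ∩ P j).Nonempty ∧ (P i ∩ P j).Nonempty with hr
  set T : Set ι := {j | ReflTransGen r i₁ j} with hT
  by_contra hcon
  have hi₂T : i₂ ∉ T := hcon
  set N : Set ι := {i | (P i).Nonempty} with hN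
  set U₁ : Set ℂ := ⋃ j ∈ N ∩ T, P j with hU₁
  set U₂ : Set ℂ := ⋃ j ∈ N ∩ ({j | (C ∩ P j).Nonempty} \ T), P j with hU₂
  have hU₁c : IsClosed U₁ := (hfin.subset inter_subset_left).isClosed_biUnion fun j _ => hclosed j
  have hU₂c : IsClosed U₂ := (hfin.subset inter_subset_left).isClosed_biUnion fun j _ => hclosed j
  have hcover : C ⊆ U₁ ∪ U₂ := by
    intro z hz
    obtain ⟨j, hj⟩ := mem_iUnion.1 (hCsub hz)
    have hjN : j ∈ N := ⟨z, hj⟩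
    by_cases hjT : j ∈ T
    · exact Or.inl (mem_biUnion ⟨hjN, hjT⟩ hj)
    · exact Or.inr (mem_biUnion ⟨hjN, ⟨⟨z, hz, hj⟩, hjT⟩⟩ hj)
  have hmeet₁ : (C ∩ U₁).Nonempty := by
    obtain ⟨z, hzC, hz⟩ := h₁
    exact ⟨z, hzC, mem_biUnion ⟨⟨z, hz⟩, (ReflTransGen.refl : ReflTransGen r i₁ i₁)⟩ hz⟩
  have hmeet₂ : (C ∩ U₂).Nonempty := by
    obtain ⟨z, hzC, hz⟩ := h₂
    exact ⟨z, hzC, mem_biUnion ⟨⟨z, hz⟩, ⟨⟨z, hzC, hz⟩, hi₂T⟩⟩ hz⟩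
  obtain ⟨z, hzC, hz₁, hz₂⟩ := (isPreconnected_closed_iff.1 hC) U₁ U₂ hU₁c hU₂c hcover hmeet₁ hmeet₂
  rw [hU₁] at hz₁
  rw [hU₂] at hz₂
  obtain ⟨j, hj, hzj⟩ := mem_iUnion₂.1 hz₁
  obtain ⟨j', hj', hzj'⟩ := mem_iUnion₂.1 hz₂
  have hstep : r j j' := ⟨hj'.2.1, ⟨z, hzj, hzj'⟩⟩
  exact hj'.2.2 (ReflTransGen.tail hj.2 hstep)

/-! ### Edge pieces of a quad -/

namespace Quad

variable (Q : Quad D) (δ : ℝ) (ω : BondConfig (Site 2))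

/-- The piece of the drawn segment of the lattice edge `p = (a, b)` inside `[Q]`.
[cite: SchrammSmirnov2011, proof of Lemma 6.1] -/
def piece (p : Site 2 × Site 2) : Set ℂ :=
  segment ℝ (meshPoint δ p.1) (meshPoint δ p.2) ∩ Q.carrier

/-- An ordered pair of adjacent sites whose edge is open. [folklore] -/
def OpenPair (ω : BondConfig (Site 2)) (p : Site 2 × Site 2) : Prop :=
  (zdGraph 2).Adj p.1 p.2 ∧ s(p.1, p.2) ∈ ω

/-- Two open edges whose pieces in `[Q]` intersect. [folklore] -/
def PieceRel (p q : Site 2 × Site 2) : Prop :=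
  OpenPair ω p ∧ OpenPair ω q ∧ (Q.piece δ p ∩ Q.piece δ q).Nonempty

/-- An open edge whose piece meets the bottom side `∂₁Q`. [folklore] -/
def IsBase (p : Site 2 × Site 2) : Prop := OpenPair ω p ∧ (Q.piece δ p ∩ Q.side 1).Nonempty

/-- An open edge chained to the bottom side through intersecting open pieces. [folklore] -/
def Reach (p : Site 2 × Site 2) : Prop := ∃ b, Q.IsBase δ ω b ∧ ReflTransGen (Q.PieceRel δ ω) b p

/-- **The bottom open cluster** `C_b(ω)`: the union of the pieces in `[Q]` of the open edges
chained to `∂₁Q`. [cite: SchrammSmirnov2011, proof of Lemma 6.1, case (3)] -/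
def bottomCluster : Set ℂ := ⋃ (p : Site 2 × Site 2) (_ : Q.Reach δ ω p), Q.piece δ p

variable {Q δ ω}

/-- Pieces are compact. [folklore] -/
theorem isCompact_piece (p : Site 2 × Site 2) : IsCompact (Q.piece δ p) :=
  (isCompact_segment_complex _ _).inter_right Q.isCompact_carrier.isClosed

/-- Pieces lie in the carrier. [folklore] -/
theorem piece_subset_carrier (p : Site 2 × Site 2) : Q.piece δ p ⊆ Q.carrier := inter_subset_right

/-- The piece of an open edge lies in the drawn open edges. [folklore] -/
theorem piece_subset_openEdgeUnion {p : Site 2 × Site 2} (hp : OpenPair ω p) :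
    Q.piece δ p ⊆ openEdgeUnion δ ω := fun _ hz =>
  mem_openEdgeUnion_iff.2 ⟨p.1, p.2, hp.1, hp.2, hz.1⟩

/-- Only finitely many lattice edges have a nonempty piece in `[Q]` (`δ > 0`). [folklore] -/
theorem finite_setOf_piece_nonempty (hδ : 0 < δ) :
    {p : Site 2 × Site 2 | (zdGraph 2).Adj p.1 p.2 ∧ (Q.piece δ p).Nonempty}.Finite := by
  obtain ⟨R₀, hR₀⟩ := Q.isCompact_carrier.isBounded.subset_closedBall (0 : ℂ)
  set W : Set (Site 2) := {v | dist (meshPoint δ v) 0 ≤ R₀ + δ} with hW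
  have hWf : W.Finite := finite_setOf_dist_meshPoint_le hδ 0 (R₀ + δ)
  refine (hWf.prod hWf).subset ?_
  rintro ⟨a, b⟩ ⟨hab, z, hzseg, hzQ⟩
  have hz0 : dist z 0 ≤ R₀ := mem_closedBall.1 (hR₀ hzQ)
  have ha : dist (meshPoint δ a) z ≤ δ := dist_meshPoint_le_of_mem_segment hδ hab hzseg
  have hb : dist (meshPoint δ b) z ≤ δ := by
    rw [segment_symm] at hzseg
    exact dist_meshPoint_le_of_mem_segment hδ hab.symm hzseg
  exact ⟨by show dist (meshPoint δ a) 0 ≤ R₀ + δ; linarith [dist_triangle (meshPoint δ a) z 0],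
    by show dist (meshPoint δ b) 0 ≤ R₀ + δ; linarith [dist_triangle (meshPoint δ b) z 0]⟩

/-! ### The bottom open cluster -/

/-- A reachable edge is open. [folklore] -/
theorem Reach.openPair {p : Site 2 × Site 2} (h : Q.Reach δ ω p) : OpenPair ω p := by
  obtain ⟨b, hb, hchain⟩ := h
  induction hchain with
  | refl => exact hb.1
  | tail _ hst _ => exact hst.2.1

/-- An open edge whose piece meets the bottom cluster is part of it. [folklore] -/
theorem Reach.of_inter {p q : Site 2 × Site 2} (hp : Q.Reach δ ω p) (hq : OpenPair ω q)
    (h : (Q.piece δ p ∩ Q.piece δ q).Nonempty) : Q.Reach δ ω q := by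
  obtain ⟨b, hb, hchain⟩ := hp
  exact ⟨b, hb, hchain.tail ⟨Reach.openPair ⟨b, hb, hchain⟩, hq, h⟩⟩

/-- The bottom cluster lies in the drawn open edges and in the carrier. [folklore] -/
theorem bottomCluster_subset :
    Q.bottomCluster δ ω ⊆ openEdgeUnion δ ω ∩ Q.carrier := by
  intro z hz
  obtain ⟨p, hp, hzp⟩ := mem_iUnion₂.1 hz
  exact ⟨piece_subset_openEdgeUnion hp.openPair hzp, piece_subset_carrier p hzp⟩

/-- The piece of a reachable edge lies in the bottom cluster. [folklore] -/
theorem piece_subset_bottomCluster {p : Site 2 × Site 2} (hp : Q.Reach δ ω p) :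
    Q.piece δ p ⊆ Q.bottomCluster δ ω := fun _ hz => mem_iUnion₂.2 ⟨p, hp, hz⟩

/-- **Maximality**: an open edge whose piece meets the bottom cluster lies in it. [folklore] -/
theorem piece_subset_bottomCluster_of_inter {q : Site 2 × Site 2} (hq : OpenPair ω q)
    (h : (Q.piece δ q ∩ Q.bottomCluster δ ω).Nonempty) : Q.piece δ q ⊆ Q.bottomCluster δ ω := by
  obtain ⟨z, hzq, hz⟩ := h
  obtain ⟨p, hp, hzp⟩ := mem_iUnion₂.1 hz
  exact piece_subset_bottomCluster (hp.of_inter hq ⟨z, hzp, hzq⟩)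

/-- The bottom cluster is compact (a finite union of pieces, `δ > 0`). [folklore] -/
theorem isCompact_bottomCluster (hδ : 0 < δ) : IsCompact (Q.bottomCluster δ ω) := by
  set F : Set (Site 2 × Site 2) := {p | Q.Reach δ ω p ∧ (Q.piece δ p).Nonempty} with hF
  have hFf : F.Finite := (finite_setOf_piece_nonempty (Q := Q) hδ).subset fun p hp =>
    ⟨hp.1.openPair.1, hp.2⟩
  have heq : Q.bottomCluster δ ω = ⋃ p ∈ F, Q.piece δ p := by
    refine subset_antisymm ?_ ?_
    · intro z hz
      obtain ⟨p, hp, hzp⟩ := mem_iUnion₂.1 hz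
      exact mem_biUnion ⟨hp, ⟨z, hzp⟩⟩ hzp
    · intro z hz
      obtain ⟨p, hp, hzp⟩ := mem_iUnion₂.1 hz
      exact mem_iUnion₂.2 ⟨p, hp.1, hzp⟩
  rw [heq]
  exact hFf.isCompact_biUnion fun p _ => isCompact_piece p

/-- **Connected chains to the bottom** (lattice-tame quads): every reachable piece lies in a
preconnected subset of the bottom cluster meeting `∂₁Q`. [folklore] -/
theorem exists_isPreconnected_of_reach
    (htame : ∀ p : Site 2 × Site 2, (zdGraph 2).Adj p.1 p.2 → IsPreconnected (Q.piece δ p))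
    {p : Site 2 × Site 2} (hp : Q.Reach δ ω p) :
    ∃ U : Set ℂ, U ⊆ Q.bottomCluster δ ω ∧ IsPreconnected U ∧ (U ∩ Q.side 1).Nonempty ∧
      Q.piece δ p ⊆ U := by
  obtain ⟨b, hb, hchain⟩ := hp
  induction hchain with
  | refl =>
    exact ⟨Q.piece δ b, piece_subset_bottomCluster ⟨b, hb, ReflTransGen.refl⟩, htame b hb.1.1,
      hb.2, subset_rfl⟩
  | @tail c d hcd hst ih =>
    obtain ⟨U, hUsub, hUpc, hU1, hcU⟩ := ih
    have hd : Q.Reach δ ω d := ⟨b, hb, hcd.tail hst⟩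
    refine ⟨U ∪ Q.piece δ d, union_subset hUsub (piece_subset_bottomCluster hd), ?_,
      hU1.mono (inter_subset_inter_left _ subset_union_left), subset_union_right⟩
    obtain ⟨z, hzc, hzd⟩ := hst.2.2
    exact IsPreconnected.union z (hcU hzc) hzd hUpc (htame d hst.2.1.1)

/-! ### Contacts with the free side and the top contact `θ_C` -/

variable (Q δ ω)

/-- The parameters of the contacts of the bottom cluster with the free side `∂₂Q`. [folklore] -/
def contactSet : Set ℝ := {t | ∃ ht : t ∈ Icc (0 : ℝ) 1, Q (1, ⟨t, ht⟩) ∈ Q.bottomCluster δ ω}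

/-- **The top contact `θ_C`**: the largest contact parameter, or `0` if there is none.
[cite: SchrammSmirnov2011, proof of Lemma 6.1, case (3)] -/
def topContact : ℝ := sSup (insert 0 (Q.contactSet δ ω))

variable {Q δ ω}

/-- The contact set lies in `[0, 1]`. [folklore] -/
theorem contactSet_subset_Icc : Q.contactSet δ ω ⊆ Icc 0 1 := fun _ ⟨ht, _⟩ => ht

/-- The contact set is closed (`δ > 0`). [folklore] -/
theorem isClosed_contactSet (hδ : 0 < δ) : IsClosed (Q.contactSet δ ω) := by
  have hcont : Continuous fun t : ℝ => Q (1, Set.projIcc 0 1 zero_le_one t) :=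
    Q.continuous_toFun.comp (continuous_const.prodMk continuous_projIcc)
  have heq : Q.contactSet δ ω = Icc 0 1 ∩ (fun t : ℝ => Q (1, Set.projIcc 0 1 zero_le_one t)) ⁻¹'
      Q.bottomCluster δ ω := by
    ext t
    constructor
    · rintro ⟨ht, hmem⟩
      refine ⟨ht, ?_⟩
      show Q (1, Set.projIcc 0 1 zero_le_one t) ∈ Q.bottomCluster δ ω
      rwa [Set.projIcc_of_mem _ ht]
    · rintro ⟨ht, hmem⟩
      refine ⟨ht, ?_⟩
      have : Q (1, Set.projIcc 0 1 zero_le_one t) ∈ Q.bottomCluster δ ω := hmem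
      rwa [Set.projIcc_of_mem _ ht] at this
  rw [heq]
  exact isClosed_Icc.inter ((isCompact_bottomCluster hδ).isClosed.preimage hcont)

/-- `0 ≤ θ_C ≤ 1`. [folklore] -/
theorem topContact_mem_Icc : Q.topContact δ ω ∈ Icc (0 : ℝ) 1 := by
  have hbdd : BddAbove (insert (0 : ℝ) (Q.contactSet δ ω)) :=
    ⟨1, fun t ht => by
      rcases ht with rfl | ht
      · norm_num
      · exact (contactSet_subset_Icc ht).2⟩
  refine ⟨le_csSup hbdd (mem_insert _ _), csSup_le ⟨0, mem_insert _ _⟩ fun t ht => ?_⟩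
  rcases ht with rfl | ht
  · norm_num
  · exact (contactSet_subset_Icc ht).2

/-- Contacts are below the top contact. [folklore] -/
theorem le_topContact {t : I} (ht : Q (1, t) ∈ Q.bottomCluster δ ω) : (t : ℝ) ≤ Q.topContact δ ω := by
  have hbdd : BddAbove (insert (0 : ℝ) (Q.contactSet δ ω)) :=
    ⟨1, fun t ht => by
      rcases ht with rfl | ht
      · norm_num
      · exact (contactSet_subset_Icc ht).2⟩
  exact le_csSup hbdd (Or.inr ⟨t.2, by simpa using ht⟩)

/-- The top contact is `0` or an actual contact (`δ > 0`). [folklore] -/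
theorem topContact_eq_zero_or_mem (hδ : 0 < δ) :
    Q.topContact δ ω = 0 ∨ Q.topContact δ ω ∈ Q.contactSet δ ω := by
  have hbdd : BddAbove (insert (0 : ℝ) (Q.contactSet δ ω)) :=
    ⟨1, fun t ht => by
      rcases ht with rfl | ht
      · norm_num
      · exact (contactSet_subset_Icc ht).2⟩
  have hclosed : IsClosed (insert (0 : ℝ) (Q.contactSet δ ω)) :=
    isClosed_singleton.union (isClosed_contactSet hδ)
  have := hclosed.csSup_mem ⟨0, mem_insert _ _⟩ hbdd
  rcases this with h | h
  · exact Or.inl h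
  · exact Or.inr h

/-! ### Open connected sets from `∂₁Q` to `∂₃Q` exclude dual crossings -/

/-- A preconnected subset of the open edges of `[Q]` meeting `∂₁Q` and `∂₃Q` meets every dual
path of `[Q]` from `∂₀Q` to `∂₂Q`; so if the dual path avoids the open edges, contradiction.
[cite: SchrammSmirnov2011, proof of Lemma 6.1, case (3)] -/
theorem false_of_open_isPreconnected (hδ : 0 < δ) {U : Set ℂ} (hU : IsPreconnected U)
    (hUO : U ⊆ openEdgeUnion δ ω) (hUQ : U ⊆ Q.carrier) (h1 : (U ∩ Q.side 1).Nonempty)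
    (h3 : (U ∩ Q.side 3).Nonempty) {β : ℝ → ℂ} (hβc : ContinuousOn β (Icc 0 1))
    (hβQ : MapsTo β (Icc 0 1) Q.carrier) (hβ0 : β 0 ∈ Q.side 0) (hβ1 : β 1 ∈ Q.side 2)
    (hβO : ∀ t ∈ Icc (0 : ℝ) 1, β t ∉ openEdgeUnion δ ω) : False := by
  have hKO : closure U ⊆ openEdgeUnion δ ω :=
    (SSContinuity.isClosed_openEdgeUnion hδ ω).closure_subset_iff.2 hUO
  have hKQ : closure U ⊆ Q.carrier := Q.isCompact_carrier.isClosed.closure_subset_iff.2 hUQ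
  have hKc : IsCompact (closure U) := Q.isCompact_carrier.of_isClosed_subset isClosed_closure hKQ
  obtain ⟨t, ht, htK⟩ := Q.exists_mem_of_isPreconnected_crossing' hKc hU.closure hKQ
    (h1.mono (inter_subset_inter_left _ subset_closure))
    (h3.mono (inter_subset_inter_left _ subset_closure)) hβc hβQ hβ0 hβ1
  exact hβO t ht (hKO htK)

/-! ### The upper arc of the free side -/

/-- The arc `{Q(1, s) : a ≤ s ≤ 1}` of the free side, as an image of a real interval. [folklore] -/
def upperArc (Q : Quad D) (a : ℝ) : Set ℂ :=
  (fun s : ℝ => Q (1, Set.projIcc 0 1 zero_le_one s)) '' Icc a 1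

/-- The upper arc is compact. [folklore] -/
theorem isCompact_upperArc (a : ℝ) : IsCompact (Q.upperArc a) :=
  isCompact_Icc.image (Q.continuous_toFun.comp (continuous_const.prodMk continuous_projIcc))

/-- The upper arc is preconnected. [folklore] -/
theorem isPreconnected_upperArc (a : ℝ) : IsPreconnected (Q.upperArc a) :=
  isPreconnected_Icc.image _
    (Q.continuous_toFun.comp (continuous_const.prodMk continuous_projIcc)).continuousOn

/-- The upper arc lies on the free side `∂₂Q`. [folklore] -/
theorem upperArc_subset_side_two (a : ℝ) : Q.upperArc a ⊆ Q.side 2 := by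
  rintro _ ⟨s, -, rfl⟩
  exact ⟨(1, Set.projIcc 0 1 zero_le_one s), rfl, rfl⟩

/-- The upper arc contains the corner `Q(1,1) ∈ ∂₃Q` when `a ≤ 1`. [folklore] -/
theorem upperArc_inter_side_three (a : ℝ) (ha : a ≤ 1) : (Q.upperArc a ∩ Q.side 3).Nonempty := by
  refine ⟨Q (1, 1), ⟨1, ⟨ha, le_rfl⟩, ?_⟩, ⟨(1, 1), rfl, rfl⟩⟩
  show Q (1, Set.projIcc 0 1 zero_le_one 1) = Q (1, 1)
  rw [Set.projIcc_right]
  rfl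

/-- Points of the upper arc have parameter `≥ a`. [folklore] -/
theorem le_of_mem_upperArc {a : ℝ} (ha0 : 0 ≤ a) {θ : I} (h : Q (1, θ) ∈ Q.upperArc a) :
    a ≤ (θ : ℝ) := by
  obtain ⟨s, hs, hsθ⟩ := h
  have hsI : s ∈ Icc (0 : ℝ) 1 := ⟨ha0.trans hs.1, hs.2⟩
  dsimp only at hsθ
  rw [Set.projIcc_of_mem _ hsI] at hsθ
  have := (Prod.ext_iff.1 (Q.injective_toFun hsθ)).2
  simp only at this
  rw [← this]
  exact hs.1

/-- Points of the upper arc are not on `∂₁Q` when `a > 0`. [folklore] -/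
theorem upperArc_inter_side_one {a : ℝ} (ha0 : 0 < a) : Q.upperArc a ∩ Q.side 1 = ∅ := by
  refine eq_empty_iff_forall_notMem.2 ?_
  rintro z ⟨⟨s, hs, rfl⟩, ⟨w, hw, hwz⟩⟩
  have hsI : s ∈ Icc (0 : ℝ) 1 := ⟨ha0.le.trans hs.1, hs.2⟩
  dsimp only at hwz
  have := Q.injective_toFun hwz
  rw [Set.projIcc_of_mem _ hsI] at this
  have h2 : (w.2 : ℝ) = s := by rw [this]
  have hw0 : (w.2 : ℝ) = 0 := by
    have : w.2 = 0 := hw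
    rw [this]; rfl
  linarith [hs.1]

/-! ### The top contact is below every dual landing -/

/-- **Dual crossings land above the top contact** (lattice-tame quads, `δ > 0`): a dual path of
`[Q]` from `∂₀Q` avoiding the open edges, which meets `∂₂Q` only at its endpoint `Q(1, θ)`, has
`θ_C ≤ θ`. [cite: SchrammSmirnov2011, proof of Lemma 6.1, case (3)] -/
theorem topContact_le_of_dualPath (hδ : 0 < δ)
    (htame : ∀ p : Site 2 × Site 2, (zdGraph 2).Adj p.1 p.2 → IsPreconnected (Q.piece δ p))
    {β : ℝ → ℂ} (hβc : ContinuousOn β (Icc 0 1)) (hβQ : MapsTo β (Icc 0 1) Q.carrier)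
    (hβ0 : β 0 ∈ Q.side 0) (hβO : ∀ t ∈ Icc (0 : ℝ) 1, β t ∉ openEdgeUnion δ ω)
    {θ : I} (hβ1 : β 1 = Q (1, θ)) (hfirst : ∀ t ∈ Ico (0 : ℝ) 1, β t ∉ Q.side 2) :
    Q.topContact δ ω ≤ θ := by
  rcases topContact_eq_zero_or_mem (Q := Q) (ω := ω) hδ with h0 | ⟨hI, hmem⟩
  · rw [h0]; exact θ.2.1
  by_contra hlt
  push Not at hlt
  set θC : ℝ := Q.topContact δ ω with hθC
  -- the chain of open pieces from `∂₁Q` to the top contact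
  obtain ⟨p, hp, hcp⟩ := mem_iUnion₂.1 hmem
  obtain ⟨U, hUsub, hUpc, hU1, hpU⟩ := exists_isPreconnected_of_reach htame hp
  have hUO : U ⊆ openEdgeUnion δ ω := fun z hz => (bottomCluster_subset (hUsub hz)).1
  have hUQ : U ⊆ Q.carrier := fun z hz => (bottomCluster_subset (hUsub hz)).2
  -- continued by the upper arc above the contact
  set V : Set ℂ := U ∪ Q.upperArc θC with hV
  have hcA : Q (1, ⟨θC, hI⟩) ∈ Q.upperArc θC :=
    ⟨θC, ⟨le_rfl, hI.2⟩, by dsimp only; rw [Set.projIcc_of_mem _ hI]⟩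
  have hVpc : IsPreconnected V :=
    IsPreconnected.union _ (hpU hcp) hcA hUpc (isPreconnected_upperArc θC)
  have hVQ : V ⊆ Q.carrier :=
    union_subset hUQ ((upperArc_subset_side_two θC).trans (Q.side_subset_carrier 2))
  have hV1 : (V ∩ Q.side 1).Nonempty := hU1.mono (inter_subset_inter_left _ subset_union_left)
  have hV3 : (V ∩ Q.side 3).Nonempty :=
    (upperArc_inter_side_three θC hI.2).mono (inter_subset_inter_left _ subset_union_right)
  -- the dual path avoids `closure V = closure U ∪ arc`
  have hKQ : closure V ⊆ Q.carrier := Q.isCompact_carrier.isClosed.closure_subset_iff.2 hVQ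
  have hKc : IsCompact (closure V) := Q.isCompact_carrier.of_isClosed_subset isClosed_closure hKQ
  have hβ12 : β 1 ∈ Q.side 2 := by rw [hβ1]; exact ⟨(1, θ), rfl, rfl⟩
  obtain ⟨t, ht, htK⟩ := Q.exists_mem_of_isPreconnected_crossing' hKc hVpc.closure hKQ
    (hV1.mono (inter_subset_inter_left _ subset_closure))
    (hV3.mono (inter_subset_inter_left _ subset_closure)) hβc hβQ hβ0 hβ12
  have hclV : closure V = closure U ∪ Q.upperArc θC := by
    rw [hV, closure_union, (isCompact_upperArc θC).isClosed.closure_eq]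
  rw [hclV] at htK
  rcases htK with htU | htA
  · exact hβO t ht ((SSContinuity.isClosed_openEdgeUnion hδ ω).closure_subset_iff.2 hUO htU)
  · rcases ht.2.eq_or_lt with h1 | h1
    · rw [h1, hβ1] at htA
      have := le_of_mem_upperArc hI.1 htA
      linarith
    · exact hfirst t ⟨ht.1, h1⟩ (upperArc_subset_side_two θC htA)

/-! ### Dual crossings landing just above the top contact -/

/-- **Low dual crossings exist** (lattice-tame quads, `δ > 0`): if `[Q]` has a dual crossing from
`∂₀Q` to `∂₂Q` off the open edges, then for every `η > 0` it has one all of whose points on `∂₂Q`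
have parameter `< θ_C + η`. [cite: SchrammSmirnov2011, proof of Lemma 6.1, case (3)] -/
theorem exists_dualPath_landing_lt (hδ : 0 < δ)
    (htame : ∀ p : Site 2 × Site 2, (zdGraph 2).Adj p.1 p.2 → IsPreconnected (Q.piece δ p))
    (hex : ∃ β : ℝ → ℂ, ContinuousOn β (Icc 0 1) ∧ MapsTo β (Icc 0 1) Q.carrier ∧ β 0 ∈ Q.side 0 ∧
      β 1 ∈ Q.side 2 ∧ ∀ t ∈ Icc (0 : ℝ) 1, β t ∉ openEdgeUnion δ ω)
    {η : ℝ} (hη : 0 < η) :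
    ∃ β : ℝ → ℂ, ContinuousOn β (Icc 0 1) ∧ MapsTo β (Icc 0 1) Q.carrier ∧ β 0 ∈ Q.side 0 ∧
      β 1 ∈ Q.side 2 ∧ (∀ t ∈ Icc (0 : ℝ) 1, β t ∉ openEdgeUnion δ ω) ∧
      ∀ t ∈ Icc (0 : ℝ) 1, ∀ θ : I, β t = Q (1, θ) → (θ : ℝ) < Q.topContact δ ω + η := by
  obtain ⟨β₀, hβ₀c, hβ₀Q, hβ₀0, hβ₀1, hβ₀O⟩ := hex
  set θC : ℝ := Q.topContact δ ω with hθC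
  have hθC0 : 0 ≤ θC := (topContact_mem_Icc (Q := Q) (δ := δ) (ω := ω)).1
  set A : Set ℂ := Q.upperArc (θC + η) with hA
  set 𝒦 : Set ℂ := (openEdgeUnion δ ω ∩ Q.carrier) ∪ A with h𝒦
  have h𝒦c : IsCompact 𝒦 :=
    (Q.isCompact_carrier.inter_left (SSContinuity.isClosed_openEdgeUnion hδ ω)).union
      (isCompact_upperArc _)
  have h𝒦sub : 𝒦 ⊆ Q.carrier :=
    union_subset inter_subset_right ((upperArc_subset_side_two _).trans (Q.side_subset_carrier 2))
  -- the pieces covering the obstacle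
  set P : Option (Site 2 × Site 2) → Set ℂ := fun i =>
    match i with
    | none => A
    | some p => {z | OpenPair ω p ∧ z ∈ Q.piece δ p} with hP
  have hPsome : ∀ p, OpenPair ω p → P (some p) = Q.piece δ p := fun p hp => by
    ext z; simp only [hP, mem_setOf_eq, hp, true_and]
  have hPsome' : ∀ p, ¬ OpenPair ω p → P (some p) = ∅ := fun p hp => by
    ext z; simp only [hP, mem_setOf_eq, hp, false_and, mem_empty_iff_false]
  have hclosed : ∀ i, IsClosed (P i) := by
    rintro (_ | p)
    · exact (isCompact_upperArc _).isClosed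
    · by_cases hp : OpenPair ω p
      · rw [hPsome p hp]; exact (isCompact_piece p).isClosed
      · rw [hPsome' p hp]; exact isClosed_empty
  have hfin : {i | (P i).Nonempty}.Finite := by
    have hF := finite_setOf_piece_nonempty (Q := Q) hδ
    refine ((hF.image some).insert none).subset ?_
    rintro (_ | p) hp
    · exact mem_insert _ _
    · refine Or.inr ⟨p, ?_, rfl⟩
      by_cases hop : OpenPair ω p
      · have : (P (some p)).Nonempty := hp
        rw [hPsome p hop] at this
        exact ⟨hop.1, this⟩
      · have : (P (some p)).Nonempty := hp
        rw [hPsome' p hop] at this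
        exact absurd this not_nonempty_empty
  have hcover : 𝒦 ⊆ ⋃ i, P i := by
    rintro z (⟨hzO, hzQ⟩ | hzA)
    · obtain ⟨x, y, hxy, hω, hzs⟩ := mem_openEdgeUnion_iff.1 hzO
      exact mem_iUnion.2 ⟨some (x, y), ⟨hxy, hω⟩, hzs, hzQ⟩
    · exact mem_iUnion.2 ⟨none, hzA⟩
  -- no connected piece of the obstacle joins `∂₁Q` to `∂₃Q`
  have hnc : ∀ C ⊆ 𝒦, IsPreconnected C → (C ∩ Q.side 1).Nonempty → (C ∩ Q.side 3).Nonempty →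
      False := by
    intro C hC hCpc ⟨b, hbC, hb1⟩ ⟨c, hcC, hc3⟩
    have hCsub : C ⊆ ⋃ i, P i := hC.trans hcover
    -- `b` lies in an open piece meeting `∂₁Q`: a base edge
    have hbA : b ∉ A := fun h => by
      have := upperArc_inter_side_one (Q := Q) (show 0 < θC + η by linarith)
      exact (eq_empty_iff_forall_notMem.1 this) b ⟨h, hb1⟩
    obtain ⟨pb, hpbO, hbpb⟩ : ∃ pb, OpenPair ω pb ∧ b ∈ Q.piece δ pb := by
      rcases hC hbC with ⟨hbO, hbQ⟩ | hbA'
      · obtain ⟨x, y, hxy, hω, hbs⟩ := mem_openEdgeUnion_iff.1 hbO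
        exact ⟨(x, y), ⟨hxy, hω⟩, hbs, hbQ⟩
      · exact absurd hbA' hbA
    have hbase : Q.IsBase δ ω pb := ⟨hpbO, ⟨b, hbpb, hb1⟩⟩
    obtain ⟨ic, hcic⟩ := mem_iUnion.1 (hCsub hcC)
    have hchain := exists_reflTransGen_of_isPreconnected P hclosed hfin hCpc hCsub
      (i₁ := some pb) (i₂ := ic) ⟨b, hbC, by rw [hPsome pb hpbO]; exact hbpb⟩ ⟨c, hcC, hcic⟩
    -- along the chain: open pieces reachable from the base, unless the arc was touched
    have key : ∀ j, ReflTransGen (fun i j => (C ∩ P j).Nonempty ∧ (P i ∩ P j).Nonempty) (some pb) j →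
        (∃ q, j = some q ∧ Q.Reach δ ω q) ∨
          ∃ k, Q.Reach δ ω k ∧ (Q.piece δ k ∩ A).Nonempty := by
      intro j hj
      induction hj with
      | refl => exact Or.inl ⟨pb, rfl, pb, hbase, ReflTransGen.refl⟩
      | @tail j₁ j₂ _ hst ih =>
        rcases ih with ⟨q, rfl, hq⟩ | hbad
        · obtain ⟨hCj₂, z, hz₁, hz₂⟩ := hst
          rw [hPsome q hq.openPair] at hz₁
          rcases j₂ with _ | q₂
          · exact Or.inr ⟨q, hq, z, hz₁, hz₂⟩
          · by_cases hq₂ : OpenPair ω q₂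
            · rw [hPsome q₂ hq₂] at hz₂
              exact Or.inl ⟨q₂, rfl, hq.of_inter hq₂ ⟨z, hz₁, hz₂⟩⟩
            · rw [hPsome' q₂ hq₂] at hz₂
              exact absurd hz₂ (notMem_empty _)
        · exact Or.inr hbad
    rcases key ic hchain with ⟨q, rfl, hq⟩ | ⟨k, hk, z, hzk, hzA⟩
    · -- an open chain from `∂₁Q` to `∂₃Q`: excluded by the given dual crossing
      rw [hPsome q hq.openPair] at hcic
      obtain ⟨U, hUsub, hUpc, hU1, hqU⟩ := exists_isPreconnected_of_reach htame hq
      exact false_of_open_isPreconnected hδ hUpc (fun z hz => (bottomCluster_subset (hUsub hz)).1)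
        (fun z hz => (bottomCluster_subset (hUsub hz)).2) hU1 ⟨c, hqU hcic, hc3⟩ hβ₀c hβ₀Q hβ₀0
        hβ₀1 hβ₀O
    · -- the bottom cluster touches the arc above `θ_C + η`: excluded by the definition of `θ_C`
      have hzC : z ∈ Q.bottomCluster δ ω := piece_subset_bottomCluster hk hzk
      obtain ⟨s, hs, hsz⟩ := hzA
      have hsI : s ∈ Icc (0 : ℝ) 1 := ⟨by linarith [hs.1], hs.2⟩
      dsimp only at hsz
      rw [Set.projIcc_of_mem _ hsI] at hsz
      rw [← hsz] at hzC
      have := le_topContact hzC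
      simp only at this
      linarith [hs.1]
  obtain ⟨β, hβc, hβQ, hβ0, hβ1, hβ𝒦⟩ := Q.exists_path_avoiding_of_not_crossed' h𝒦c h𝒦sub hnc
  refine ⟨β, hβc, hβQ, hβ0, hβ1, fun t ht hO => hβ𝒦 t ht (Or.inl ⟨hO, hβQ ht⟩), fun t ht θ hθ => ?_⟩
  by_contra hge
  push Not at hge
  refine hβ𝒦 t ht (Or.inr ?_)
  rw [hθ]
  exact ⟨θ, ⟨hge, θ.2.2⟩, by dsimp only; rw [Set.projIcc_of_mem _ θ.2]⟩


end Quad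

end QuadCrossing

end Literature.Probability.Percolation
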